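import Literature.MathematicalPhysics.QuantumFieldTheory.Balaban1983to89.B5QGGQ145Gamma1
import Literature.MathematicalPhysics.QuantumFieldTheory.Balaban1983to89.B5

/-!
# `Balaban1983to89.B5Gamma1FailsLargeA` — [Balaban1984PropagatorsI] p. 26 «γ₁ = a⁻²» (row B5.Eq1.45): the printed
upper value FAILS for large `a` — the GAPS G-B5-13 witness (d = 2, L = 3, k = 1, p′ = (π, 0), a = 310) as KERNEL THEOREMS
on the tree's own torus symbol `ev` and torus operator `qggq`, and the skeleton's typed sentence `B5.Bounds145Printed`
REFUTED for the torus family over all `a > 0` (while it HOLDS for `0 < a ≤ 1`, `B5QGGQ145Gamma1.printed_bounds_small_a`)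

statement-level skeleton of published theorems with citation tags; proofs where landed; nothing here is a claim about the Yang–Mills mass gap

CITATION HEADER.  T. Bałaban, *Propagators and renormalization transformations for lattice gauge theories. I*, Commun.
Math. Phys. **95** (1984) 17–40 [Balaban1984PropagatorsI] (cell paper B5; PDF held `paper:balaban1984-cmp95-propagators-rt-i`,
journal page = PDF page + 16), p. 25 [PDF 9] and p. 26 [PDF 10].  Unit `lit-balaban-r02` gen 3 (B5 reader/typer and fold
owner; HOME `run/shared/lean/pub/lit-balaban/`).  SKELETON row **B5.Eq1.45** carries since v1 the status «refuted-as-printed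
(γ₁ = a⁻², large a)» (cell census GAPS G-B5-13) with, as evidence, the docstring arithmetic `B5.printed_gamma1_fails`
(`310²·(43/243) > (310·11/27 + 4)²`) and the positive theorem for `0 < a ≤ 1` (`…B5QGGQ145Gamma1.printed_bounds_small_a`,
`ev_le_inv_sq`).  This file makes the refutation a theorem ABOUT THE TREE'S OBJECTS: the eigenvalue `…B5QGGQ145Bounds.ev`
of `Q′_kG′_k²Q′_k*` on the unit torus and the kernel `…B5QGGQ145Torus.qggq`.

WHAT IS PRINTED (verbatim).  p. 25: *"We have bounds 0 < Q′_kG′_k²Q′_k* ≦ a⁻², and they imply the existence of the inverse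
operator and a bound from below."*  p. 26, after (1.45): *"From this representation and from the bounds (2.51), (2.52) of that
paper, it follows that there are positive constants γ₀, γ₁, in fact γ₀ dependent only on d, γ₁ = a⁻², such that
γ₀ ≦ Q′_kG′_k²Q′_k* ≦ γ₁."*  (1.45): *"(Q′_kG′_k²Q′_k*)~(p′) = Σ_l |u_k(p′+l)|² Δ₀²(p′)/Δ²(p′+l) · [a Σ_l |u_k(p′+l)|² Δ₀(p′)/Δ(p′+l)
+ Δ₀(p′)]⁻²"*, typed as `…B5QGGQ145Torus.m145` / regrouped `mReg = 𝒩/E²` (`B5Strip145.Ncalr`, `B4Strip.Er`), whose value at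
a dual momentum of a torus is `…B5QGGQ145Bounds.ev`.

THE WITNESS (G-B5-13, `B5.lean` docstring of `printed_gamma1_fails`): `d = 2` (here: the `2`-component momenta `Fin 2`, i.e.
`d + 1 = 2` in the `Fin (d + 1)` indexing of the torus files), `L = 3`, `k = 1` (`n = L^k = 3`), the `2 × 2` unit torus
`N = (2, 2)` and its dual momentum `k₀ = (1, 0)`, i.e. `p′ = (−π, 0)` (`dualMomentum_two`; the representative of `1/2` in
`[−1/2, 1/2)` is `−1/2`).  There the three shifted momenta `l = 2π(k₀′, 0)`, `k₀′ ∈ {0, 1, 2}` have `|u(p′+l)|² = 4/9, 4/9, 1/9`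
and `Δ(p′+l) = 9, 9, 36` (all other `l` give `|u|² = 0`), `Δ(p′) = 9`, so `E = 9 + 11a/12`, `𝒩 = 43/48` and
`ev = (43/48)/(9 + 11a/12)²` (`ev_two_eq`) — which exceeds `a⁻²` iff `a² − 297a − 1458 > 0`, e.g. at `a = 310`
(`inv_sq_lt_ev_310`; the same numbers as `B5.printed_gamma1_fails` up to the factor `(9/4)²`).

WHAT THIS FILE PROVES.  §1 the trigonometric values (cos(π/3) = 1/2, cos π = −1) feeding `S1r`, `Sxir 3`, `uFactorr 3`;
§2 `DeltaXir`/`Ur`/`Er`/`Ncalr` at `p′ = (−π, 0)`, `n = 3` (`Er_s0 : Er 3 a 0 s0 = 9 + 11·a/12`, `Ncalr_s0 : Ncalr 3 s0 = 43/48`);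
§3 `dualMomentum_two`, **`ev_two_eq`**, **`inv_sq_lt_ev_310 : (310²)⁻¹ < ev 3 310 (2,2) (1,0)`**, hence
**`not_ev_le_inv_sq`**: the bound `ev ≤ a⁻²` of `ev_le_inv_sq` does NOT extend from `0 < a ≤ 1` to all `a > 0`;
§4 the operator statement: for the grid character `ω₀(y) = e^{ip′_{k₀}·y}` on the `2 × 2` torus,
`Re⟨ω₀, Q′G′²Q′*ω₀⟩ = 4·ev` and `Σ_y|ω₀(y)|² = 4` (`form_character`, `normSq_character`), so **`printed_upper_bound_fails`**:
`¬ ∀ ω, Re⟨ω, Q′G′²Q′*ω⟩ ≤ a⁻² Σ_y|ω(y)|²` at `a = 310`, `n = 3`; §5 the skeleton sentence: for the torus family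
`torusForm a` (`n = 3`, `N = (2,2)`, all `a > 0`) **`not_bounds145Printed_all_a : ¬ B5.Bounds145Printed (…)`**, while
`bounds145Printed_small_a : B5.Bounds145Printed (…)` for the same forms indexed by `0 < a ≤ 1` (from
`printed_bounds_small_a`).  HONEST SCOPE: one explicit witness; the threshold in `a` (≈ 301.8 at this momentum; float
thresholds 26–46 at other data, G-B5-13) is not located; nothing here bears on the series, which fixes `a = 1` (p. 26 l.7–9).
No `sorry`, no new `def … : Prop`; axioms standard.
-/

namespace Literature.MathematicalPhysics.QuantumFieldTheory.Balaban1983to89.B5Gamma1FailsLargeA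

open Real Finset Complex ComplexConjugate UnitAddTorus
open Literature.MathematicalPhysics.QuantumFieldTheory.Balaban1983to89
open B4Strip B5Strip145 B4TorusKernel B4TorusGreen244 B4TorusPositivity B5QGGQ145Torus B5QGGQ145Bounds

noncomputable section

/-! ## §1  Trigonometric values -/

/-- `2 − 2cos(−π) = 4`. [folklore] -/
private theorem S1r_neg_pi : S1r (-π) = 4 := by
  rw [S1r, Real.cos_neg, Real.cos_pi]; norm_num

/-- `2 − 2cos 0 = 0`. [folklore] -/
private theorem S1r_zero : S1r 0 = 0 := by
  rw [S1r, Real.cos_zero]; norm_num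

/-- `S_ξ(−π) = 9(2 − 2cos(π/3)) = 9` for `ξ = 1/3`. [folklore] -/
private theorem Sxir_three_neg_pi : Sxir 3 (-π) = 9 := by
  rw [Sxir, show (-π) / ((3 : ℕ) : ℝ) = -(π / 3) by push_cast; ring, Real.cos_neg, Real.cos_pi_div_three]
  norm_num

/-- `S_ξ(0) = 0`. [folklore] -/
private theorem Sxir_three_zero : Sxir 3 0 = 0 := by
  rw [Sxir, zero_div, Real.cos_zero]; norm_num

/-- `S_ξ(−π + 2π) = 9(2 − 2cos(π/3)) = 9`. [folklore] -/
private theorem Sxir_three_shift_one : Sxir 3 (-π + 2 * π * ((1 : ℕ) : ℝ)) = 9 := by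
  rw [Sxir, show (-π + 2 * π * ((1 : ℕ) : ℝ)) / ((3 : ℕ) : ℝ) = π / 3 by push_cast; ring, Real.cos_pi_div_three]
  norm_num

/-- `S_ξ(−π + 4π) = 9(2 − 2cos π) = 36`. [folklore] -/
private theorem Sxir_three_shift_two : Sxir 3 (-π + 2 * π * ((2 : ℕ) : ℝ)) = 36 := by
  rw [Sxir, show (-π + 2 * π * ((2 : ℕ) : ℝ)) / ((3 : ℕ) : ℝ) = π by push_cast; ring, Real.cos_pi]
  norm_num

/-- `S_ξ(0 + 2πk) ` is irrelevant: the factors at the zero momentum component vanish for `k ≠ 0`; for `k = 0`,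
`S_ξ(0 + 0) = 0`. [folklore] -/
private theorem Sxir_three_zero_shift_zero : Sxir 3 (0 + 2 * π * ((0 : ℕ) : ℝ)) = 0 := by
  rw [show (0 : ℝ) + 2 * π * ((0 : ℕ) : ℝ) = 0 by push_cast; ring]; exact Sxir_three_zero

/-- `|u|²`-factor at `p′_μ = −π`, `l_μ = 0`: `4/9`. [folklore] -/
private theorem uFactorr_zero_neg_pi : uFactorr 3 0 (-π) = 4 / 9 := by
  have hπ : (-π : ℝ) ≠ 0 := neg_ne_zero.mpr Real.pi_ne_zero
  rw [uFactorr, if_pos rfl, if_neg hπ, S1r_neg_pi, Sxir_three_neg_pi]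

/-- `|u|²`-factor at `p′_μ = −π`, `l_μ = 2π`: `4/9`. [folklore] -/
private theorem uFactorr_one_neg_pi : uFactorr 3 1 (-π) = 4 / 9 := by
  rw [uFactorr, if_neg one_ne_zero, S1r_neg_pi, Sxir_three_shift_one]

/-- `|u|²`-factor at `p′_μ = −π`, `l_μ = 4π`: `1/9`. [folklore] -/
private theorem uFactorr_two_neg_pi : uFactorr 3 2 (-π) = 1 / 9 := by
  rw [uFactorr, if_neg two_ne_zero, S1r_neg_pi, Sxir_three_shift_two]; norm_num

/-- `|u|²`-factor at `p′_μ = 0`, `l_μ = 0`: `1` (the filled removable singularity). [folklore] -/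
private theorem uFactorr_zero_zero : uFactorr 3 0 0 = 1 := by
  rw [uFactorr, if_pos rfl, if_pos rfl]

/-- `|u|²`-factor at `p′_μ = 0`, `l_μ ≠ 0`: `0`. [folklore] -/
private theorem uFactorr_succ_zero (k : ℕ) : uFactorr 3 (k + 1) 0 = 0 := by
  rw [uFactorr, if_neg (Nat.succ_ne_zero k), S1r_zero, zero_div]

/-! ## §2  The symbol pieces at `p′ = (−π, 0)`, `n = 3` -/

/-- the witness momentum `p′ = (−π, 0)` (the dual momentum `(1, 0)` of the `2 × 2` unit torus). [folklore] -/
def s0 : Fin 2 → ℝ := ![-π, 0]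

/-- first component of the witness momentum. [folklore] -/
@[simp] private theorem s0_zero : s0 0 = -π := rfl

/-- second component of the witness momentum. [folklore] -/
@[simp] private theorem s0_one : s0 1 = 0 := rfl

/-- `|u(p′+l)|²` factorises over the two components. [folklore] -/
private theorem Ur_s0 (k : Fin 2 → Fin 3) : Ur 3 k s0 = uFactorr 3 (k 0 : ℕ) (-π) * uFactorr 3 (k 1 : ℕ) 0 := by
  rw [Ur, Fin.prod_univ_two, s0_zero, s0_one]

/-- the `l` with a non-zero second component contribute nothing (`|u|² = 0` there). [folklore] -/
private theorem Ur_s0_eq_zero {k : Fin 2 → Fin 3} (hk : k 1 ≠ 0) : Ur 3 k s0 = 0 := by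
  rw [Ur_s0]
  obtain ⟨j, hj⟩ : ∃ j : ℕ, (k 1 : ℕ) = j + 1 :=
    Nat.exists_eq_add_one_of_ne_zero (fun h => hk (Fin.ext (by simpa using h)))
  rw [hj, uFactorr_succ_zero, mul_zero]

/-- `|u(p′)|² = 4/9`. [folklore] -/
private theorem Ur_s0_00 : Ur 3 (fun _ => (0 : Fin 3)) s0 = 4 / 9 := by
  rw [Ur_s0]; simp only [Fin.val_zero]; rw [uFactorr_zero_neg_pi, uFactorr_zero_zero]; norm_num

/-- `|u(p′ + 2π(1,0))|² = 4/9`. [folklore] -/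
private theorem Ur_s0_10 : Ur 3 ![1, 0] s0 = 4 / 9 := by
  rw [Ur_s0]
  simp only [Matrix.cons_val_zero, Matrix.cons_val_one, Fin.val_one, Fin.val_zero]
  rw [uFactorr_one_neg_pi, uFactorr_zero_zero]; norm_num

/-- `|u(p′ + 2π(2,0))|² = 1/9`. [folklore] -/
private theorem Ur_s0_20 : Ur 3 ![2, 0] s0 = 1 / 9 := by
  rw [Ur_s0]
  simp only [Matrix.cons_val_zero, Matrix.cons_val_one, Fin.val_two, Fin.val_zero]
  rw [uFactorr_two_neg_pi, uFactorr_zero_zero]; norm_num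

/-- `Δ(p′) = 9`. [folklore] -/
private theorem DeltaXir_s0 : DeltaXir 3 0 s0 = 9 := by
  rw [DeltaXir, Fin.sum_univ_two, s0_zero, s0_one, Sxir_three_neg_pi, Sxir_three_zero]; norm_num

/-- `Δ(p′ + 2π(1,0)) = 9`. [folklore] -/
private theorem DeltaXir_shift10 : DeltaXir 3 0 (shiftr 3 ![1, 0] s0) = 9 := by
  rw [DeltaXir, Fin.sum_univ_two]
  simp only [shiftr, s0_zero, s0_one, Matrix.cons_val_zero, Matrix.cons_val_one, Fin.val_one, Fin.val_zero]
  rw [Sxir_three_shift_one, Sxir_three_zero_shift_zero]; norm_num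

/-- `Δ(p′ + 2π(2,0)) = 36`. [folklore] -/
private theorem DeltaXir_shift20 : DeltaXir 3 0 (shiftr 3 ![2, 0] s0) = 36 := by
  rw [DeltaXir, Fin.sum_univ_two]
  simp only [shiftr, s0_zero, s0_one, Matrix.cons_val_zero, Matrix.cons_val_one, Fin.val_two, Fin.val_zero]
  rw [Sxir_three_shift_two, Sxir_three_zero_shift_zero]; norm_num

/-- Enumeration of the sum over `l ≠ 0`: only `l = 2π(1,0)` and `l = 2π(2,0)` survive. [folklore] -/
private theorem sum_erase_s0 (g : (Fin 2 → Fin 3) → ℝ) :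
    ∑ k ∈ (Finset.univ.erase (fun _ => (0 : Fin 3))), Ur 3 k s0 * g k
      = 4 / 9 * g ![1, 0] + 1 / 9 * g ![2, 0] := by
  rw [Finset.sum_erase_eq_sub (Finset.mem_univ _)]
  have henum : ∑ k : Fin 2 → Fin 3, Ur 3 k s0 * g k = ∑ i : Fin 3, ∑ j : Fin 3, Ur 3 ![i, j] s0 * g ![i, j] := by
    rw [← Fintype.sum_prod_type']
    refine Fintype.sum_equiv (piFinTwoEquiv fun _ => Fin 3) _ _ fun k => ?_
    have hk : k = ![k 0, k 1] := by ext i; fin_cases i <;> rfl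
    simp only [piFinTwoEquiv_apply]
    rw [← hk]
  rw [henum, Fin.sum_univ_three, Fin.sum_univ_three, Fin.sum_univ_three, Fin.sum_univ_three]
  have hz : ∀ i : Fin 3, ∀ j : Fin 3, j ≠ 0 → Ur 3 ![i, j] s0 * g ![i, j] = 0 := fun i j hj => by
    rw [Ur_s0_eq_zero (by simpa using hj), zero_mul]
  rw [hz 0 1 (by decide), hz 0 2 (by decide), hz 1 1 (by decide), hz 1 2 (by decide), hz 2 1 (by decide),
    hz 2 2 (by decide)]
  have h00 : (![0, 0] : Fin 2 → Fin 3) = fun _ => 0 := by ext i; fin_cases i <;> rfl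
  rw [h00, Ur_s0_00, Ur_s0_10, Ur_s0_20]
  ring

/-- **`E(p′) = 9 + 11a/12`** at the witness: the bracket of (1.45), regrouped as `Δ(p′)·[1 + aΣ_l |u(p′+l)|²/Δ(p′+l)]`, at
`p′ = (−π, 0)`, `n = 3`. [cite: Balaban1984PropagatorsI, (1.45) p.26] -/
theorem Er_s0 (a : ℝ) : Er 3 a 0 s0 = 9 + 11 * a / 12 := by
  rw [Er, sum_erase_s0, DeltaXir_s0, DeltaXir_shift10, DeltaXir_shift20, Ur_s0_00]
  ring

/-- **`𝒩(p′) = 43/48`** at the witness: the first sum of (1.45), regrouped as `|u(p′)|² + Δ²(p′)Σ_{l≠0} |u(p′+l)|²/Δ²(p′+l)`,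
at `p′ = (−π, 0)`, `n = 3`. [cite: Balaban1984PropagatorsI, (1.45) p.26] -/
theorem Ncalr_s0 : Ncalr 3 s0 = 43 / 48 := by
  have hX : Xner 3 s0 = 4 / 9 / 9 ^ 2 + 1 / 9 / 36 ^ 2 := by
    rw [Xner]
    have := sum_erase_s0 (fun k => 1 / DeltaXir 3 0 (shiftr 3 k s0) ^ 2)
    simp only [mul_one_div] at this
    rw [this, DeltaXir_shift10, DeltaXir_shift20]
  rw [Ncalr, hX, DeltaXir_s0, Ur_s0_00]
  norm_num

/-! ## §3  The `2 × 2` torus: the eigenvalue at the dual momentum `(1, 0)` -/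

/-- the `2 × 2` unit torus. [folklore] -/
def N2 : Fin 2 → ℕ := fun _ => 2

/-- its dual momentum index `(1, 0)`. [folklore] -/
def k10 : (i : Fin 2) → Fin (N2 i) := fun i => (![1, 0] : Fin 2 → Fin 2) i

/-- the periods are positive. [folklore] -/
private theorem N2_pos : ∀ i, 1 ≤ N2 i := fun _ => by simp [N2]

/-- the dual momentum `(1, 0)` of the `2 × 2` torus is `p′ = (−π, 0)` (representatives in `[−1/2, 1/2)`; the momenta
`p_μ = (π/L′_μ)n_μ`, `−L′_μ ≦ n_μ < L′_μ` of (1.29)). [cite: Balaban1984PropagatorsI, (1.29) p.23] -/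
theorem dualMomentum_two : dualMomentum N2 k10 = s0 := by
  funext i
  fin_cases i
  · show 2 * π * rep (MultiPeriod.gridPt N2 k10 0) = -π
    have h : MultiPeriod.gridPt N2 k10 0 = ((1 / 2 : ℝ) : UnitAddCircle) := by
      simp [MultiPeriod.gridPt, N2, k10]
    rw [h, rep_coe_half]; ring
  · show 2 * π * rep (MultiPeriod.gridPt N2 k10 1) = 0
    have h : MultiPeriod.gridPt N2 k10 1 = ((0 : ℝ) : UnitAddCircle) := by
      simp [MultiPeriod.gridPt, N2, k10]
    rw [h, rep_coe (by norm_num)]; ring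

/-- **the eigenvalue of `Q′G′²Q′*` (n = 3) at the dual momentum `(1,0)` of the `2 × 2` torus:
`ev = (43/48)/(9 + 11a/12)²`** (every real `a`). [cite: Balaban1984PropagatorsI, (1.45) p.26] -/
theorem ev_two_eq (a : ℝ) : ev 3 a N2 k10 = (43 / 48) / (9 + 11 * a / 12) ^ 2 := by
  rw [ev, dualMomentum_two, Ncalr_s0, Er_s0]

/-- **G-B5-13 as a theorem on the tree's symbol: at `a = 310` the eigenvalue exceeds the printed `γ₁ = a⁻²`.**
[cite: Balaban1984PropagatorsI, p.26 after (1.45)] -/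
theorem inv_sq_lt_ev_310 : ((310 : ℝ) ^ 2)⁻¹ < ev 3 310 N2 k10 := by
  rw [ev_two_eq]; norm_num

/-- Hence the upper bound `ev ≤ a⁻²` (`B5QGGQ145Gamma1.ev_le_inv_sq`, proved for `0 < a ≤ 1`) does NOT hold for all
`a > 0`: the printed «γ₁ = a⁻²» is false as a statement for every `a`. [cite: Balaban1984PropagatorsI, p.26 after (1.45)] -/
theorem not_ev_le_inv_sq :
    ¬ ∀ a : ℝ, 0 < a → ∀ (N : Fin 2 → ℕ) (k : (i : Fin 2) → Fin (N i)), ev 3 a N k ≤ (a ^ 2)⁻¹ := by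
  intro h
  exact absurd (h 310 (by norm_num) N2 k10) (not_le.mpr inv_sq_lt_ev_310)

/-! ## §4  The operator statement on the `2 × 2` torus -/

/-- the grid character `ω₀(y) = e^{ip′_{k₀}·y}` at `k₀ = (1, 0)`. [folklore] -/
def chi0 : (Fin 2 → ℤ) → ℂ := fun y => mFourier y (MultiPeriod.gridPt N2 k10)

/-- its finite Fourier transform is concentrated at `k₀` with mass `|T₁| = 4`. [folklore] -/
private theorem dft_chi0 (k : (i : Fin 2) → Fin (N2 i)) : dft N2 chi0 k = if k = k10 then 4 else 0 := by
  rw [dft]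
  have h := sum_box_mFourier_mul_conj N2_pos k k10
  simp only [chi0] at h ⊢
  rw [h]
  have h4 : ∏ i : Fin 2, ((N2 i : ℕ) : ℂ) = 4 := by rw [Fin.prod_univ_two]; simp [N2]; norm_num
  rw [h4]

/-- `Σ_y |ω₀(y)|² = 4`. [folklore] -/
private theorem normSq_chi0 : ∑ y ∈ box N2, ‖chi0 y‖ ^ 2 = 4 := by
  rw [plancherel_box_real N2_pos]
  simp only [dft_chi0]
  have h4 : ∏ i : Fin 2, ((N2 i : ℕ) : ℝ) = 4 := by rw [Fin.prod_univ_two]; simp [N2]; norm_num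
  rw [h4]
  have : ∑ k : (i : Fin 2) → Fin (N2 i), ‖(if k = k10 then (4 : ℂ) else 0)‖ ^ 2
      = ∑ k : (i : Fin 2) → Fin (N2 i), (if k = k10 then (16 : ℝ) else 0) := by
    refine Finset.sum_congr rfl fun k _ => ?_
    split_ifs <;> norm_num
  rw [this, Finset.sum_ite_eq', if_pos (Finset.mem_univ _)]; norm_num

/-- `Re⟨ω₀, Q′G′²Q′*ω₀⟩ = 4·ev(k₀)` (`n = 3`, any `a`). [cite: Balaban1984PropagatorsI, (1.45) p.26] -/
theorem form_chi0 (a : ℝ) :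
    (∑ y ∈ box N2, ∑ y' ∈ box N2, conj (chi0 y) * qggq 3 a 0 N2 y y' * chi0 y').re = 4 * ev 3 a N2 k10 := by
  rw [form_qggq_re 3 (by norm_num) a N2_pos]
  simp only [dft_chi0]
  have h4 : ∏ i : Fin 2, ((N2 i : ℕ) : ℝ) = 4 := by rw [Fin.prod_univ_two]; simp [N2]; norm_num
  rw [h4]
  have : ∑ k : (i : Fin 2) → Fin (N2 i), ev 3 a N2 k * ‖(if k = k10 then (4 : ℂ) else 0)‖ ^ 2
      = ∑ k : (i : Fin 2) → Fin (N2 i), (if k = k10 then 16 * ev 3 a N2 k10 else 0) := by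
    refine Finset.sum_congr rfl fun k _ => ?_
    split_ifs with hk
    · rw [hk]; norm_num; ring
    · norm_num
  rw [this, Finset.sum_ite_eq', if_pos (Finset.mem_univ _)]; ring

/-- **The printed upper bound «Q′_kG′_k²Q′_k* ≦ a⁻²» FAILS as an operator inequality at `a = 310`** (`d = 2`, `L = 3`,
`k = 1`, the `2 × 2` unit torus, the character `ω₀`). [cite: Balaban1984PropagatorsI, p.25 («0 < Q′_kG′_k²Q′_k* ≦ a⁻²»),
p.26 after (1.45) («γ₁ = a⁻²»)] -/
theorem printed_upper_bound_fails :
    ¬ ∀ ω : (Fin 2 → ℤ) → ℂ,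
      (∑ y ∈ box N2, ∑ y' ∈ box N2, conj (ω y) * qggq 3 310 0 N2 y y' * ω y').re
        ≤ ((310 : ℝ) ^ 2)⁻¹ * ∑ y ∈ box N2, ‖ω y‖ ^ 2 := by
  intro h
  have h1 := h chi0
  rw [form_chi0, normSq_chi0] at h1
  have h2 := inv_sq_lt_ev_310
  linarith

/-! ## §5  The skeleton's typed sentence `B5.Bounds145Printed` on the torus family -/

/-- the projector form `⟨ω, Q′G′²Q′*ω⟩` on the `2 × 2` unit torus with `n = 3`, as an instance of the abstract carrier
`B5.ProjFormData` of the typed sentence. [cite: Balaban1984PropagatorsI, p.26 after (1.45)] -/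
def torusForm (a : ℝ) : B5.ProjFormData where
  Cfg := (Fin 2 → ℤ) → ℂ
  a := a
  qf := fun ω => (∑ y ∈ box N2, ∑ y' ∈ box N2, conj (ω y) * qggq 3 a 0 N2 y y' * ω y').re
  nsq := fun ω => ∑ y ∈ box N2, ‖ω y‖ ^ 2

/-- **`B5.Bounds145Printed` («γ₀ ≦ Q′G′²Q′* ≦ γ₁, γ₁ = a⁻²») is FALSE for the torus family over all `a > 0`** —
the «refuted-as-printed» status of row B5.Eq1.45 as a kernel theorem. [cite: Balaban1984PropagatorsI, p.26 after (1.45)] -/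
theorem not_bounds145Printed_all_a : ¬ B5.Bounds145Printed (fun a : {a : ℝ // 0 < a} => torusForm a.1) := by
  rintro ⟨γ₀, -, h⟩
  exact printed_upper_bound_fails fun ω => (h ⟨310, by norm_num⟩ ω).2

/-- … while for `0 < a ≤ 1` (the regime of the series, «e.g. a = 1», p. 26) the same sentence HOLDS for these forms
(`B5QGGQ145Gamma1.printed_bounds_small_a`). [cite: Balaban1984PropagatorsI, p.26 after (1.45)] -/
theorem bounds145Printed_small_a : B5.Bounds145Printed (fun a : {a : ℝ // 0 < a ∧ a ≤ 1} => torusForm a.1) := by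
  obtain ⟨γ₀, hγ₀, h⟩ := B5QGGQ145Gamma1.printed_bounds_small_a 1
  refine ⟨γ₀, hγ₀, fun a ω => ?_⟩
  obtain ⟨h1, h2, -⟩ := h 3 (by norm_num) a.1 a.2.1 a.2.2 N2 N2_pos ω
  exact ⟨h1, h2⟩

end

end Literature.MathematicalPhysics.QuantumFieldTheory.Balaban1983to89.B5Gamma1FailsLargeA
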